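import Summits.BirchSwinnertonDyer.BirchSwinnertonDyer.Theorems.GenusKolyvaginAtTwoMinimalTwinBSDTwoSwappedPairDescent
import Literature.NumberTheory.EllipticCurves.KrizLi2019.AssumptionStarTwoPrimitiveProofs
import HarnessLib

/-!
# Route `GenusKolyvaginAtTwo`, crux U₂ `MinimalTwinBSDTwo` (stmt-BirchSwinnertonDyer-22985), LINE 23 «twin_swap» (exponent stubs EXP±_all):
# A PER-PAIR CERTIFICATE FOR THE NON-DIVISIBILITY HALF AT EVERY DEPTH — Kriz–Li's (★) one level up per unit of depth

Seat `bsd-line-gk2-p3` g32 (PROVER seat 3/3, cell `bsd-f1-sign2`), `--supports stmt-BirchSwinnertonDyer-22985` (helper; closes nothing); companion of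
`…K1NegSuHalvesDepthOneCertificate` (p782291, the same logarithm argument used for LINE 30's depth-one frame).  THEOREMS ONLY (no definition, no named
fact, no `sorry`); standard axioms; UNCONDITIONAL.  **BSD is NOT proved by this file; U₂ / EXP± are NOT proved; no item is closed; no pair is shown to
satisfy the certificate.**

THE POINT.  LINE 23's exponent stubs EXP⁻_all / EXP⁺_all ask, at a reversed Heegner frame of a rank-one `W` with depth `M = ord₂ c + ord₂ C(W)`, for
`2^M ∣ P(1)` (DIV) and `2^(M+1) ∤ P(1)` (NDIV) in `E(K[1])`.  DIV is certifiable per pair by exhibition; for NDIV, gk2-p2 g24 recorded Kriz–Li's (★) as the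
certificate AT DEPTH `0` (`TwinSwap.Star.twoDivExponent_clauses_zero_of_assumptionStar`).  Kriz–Li's Lemma 5.4 argument runs at every level: if
`‖log_W(m • P₂)‖ > 2^{-(M+2)}` (`m = c₂·|Ẽ^{ns}(𝔽₂)|`, `P₂ = j(P₀)` the Heegner point at a prime of `K` above `2`) then `P₀ ∉ 2^(M+1) E(K) + E(K)_tors`,
hence (McCallum's descent `K[1] → K`, `E(K[1])[2] = 0`) `P(1) ∉ 2^(M+1) E(K[1])`.

* `not_exists_two_pow_zsmul_eq_derivedPoint_of_norm_padicLogPoint` — `W/ℚ` globally minimal with `E(ℚ)[2] = 0`; `K` imaginary quadratic with odd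
  `d_K`, Heegner for `N_W`; ANY datum `Dt`, `d₁` conductor-`1`, `P₀ ∈ E(K)` under `P(1)`, `j : K → ℚ₂`, `M : ℕ` with **`2^{-(M+2)} < ‖log_W(m • j P₀)‖`**
  ⟹ **`¬ ∃ Q ∈ E(K[1]), 2^(M+1) • Q = P(1)`** — the NDIV half of EXP at depth `M`, certified.  At `M = 0` and in (★)-currency
  (`‖log(m•P₂)/(c₂ c_E)‖ = 2⁻¹`, `c₂`, `c_E` odd) this is (★) ⟹ `P(1) ∉ 2E(K[1])`; in general the (★)-currency value `2^{-(t+1)}` with `ord₂ c_E = e`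
  reads `‖log(m•P₂)‖ = 2^{-(e+t+1)}`, i.e. `M = e + t = ord₂ c + ord₂ C(W)` — exactly EXP's depth.
* `depthCertificate_iff_norm` — bookkeeping: `‖log(m•P₂)/(c₂·c_E)‖ = 2^{-(t+1)}` with `c₂` odd ⟺ `‖log(m•P₂)‖ = 2^{-(t+1)} · 2^{-ord₂ c_E}`.

References: [KrizLi2019] FMS Lemma 5.4 (proof), Thm. 1.12; [McCallumLMS1991] §5 Lemma 5.1; [SilvermanAEC2009] IV.6.4, VII.2.1–2.2.
-/

set_option autoImplicit false
set_option linter.dupNamespace false -- `Summit.<P>.<Sub>` repeats `BirchSwinnertonDyer` (D-0017)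

noncomputable section

open scoped Classical

open WeierstrassCurve NumberField Literature.NumberTheory.EllipticCurves Literature.NumberTheory.EllipticCurves.ModularForms
  Literature.NumberTheory.EllipticCurves.KrizLi2019
  Summit.BirchSwinnertonDyer.Rank1Residual
  Summit.BirchSwinnertonDyer.BirchSwinnertonDyer.Theorems.CMExactDescent Summit.BirchSwinnertonDyer.BirchSwinnertonDyer.Theorems.GenusExact.TwinSwap

namespace Summit.BirchSwinnertonDyer.BirchSwinnertonDyer.Theorems.GenusExact.TwinSwap.DepthCertificate

/-- **NDIV at depth `M`, certified by the `2`-adic logarithm of the Heegner point.**  `W/ℚ` globally minimal with `E(ℚ)[2] = 0`; `K` imaginary quadratic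
with odd `d_K`, Heegner for `N_W`; a datum `Dt`, a conductor-`1` datum `d₁`, `P₀ ∈ E(K)` mapping to `P(1)`, `j : K → ℚ₂`, and `M : ℕ` with
`2^{-(M+2)} < ‖log_W(m • j P₀)‖` (`m = c₂(E)·|Ẽ^{ns}(𝔽₂)|`).  Then `P(1) ∉ 2^(M+1) E(K[1])`.  Proof: a `2^(M+1)`-th root in `E(K[1])` descends to `E(K)`
(McCallum 5.1; `E(K[1])` has no `2`-torsion), and `log(m • (2^(M+1) Q)) = 2^(M+1) log(m • Q)` has norm `≤ 2^{-(M+1)}·2⁻¹` (Kriz–Li Lemma 5.4's estimate, `m • Q ∈ E₁(ℚ₂)`).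
UNCONDITIONAL. [cite: KrizLi2019, Lemma 5.4 (FMS p. 32), proof] [cite: McCallumLMS1991, §5 Lemma 5.1] [cite: SilvermanAEC2009, IV.6.4 and VII.2.2] -/
theorem not_exists_two_pow_zsmul_eq_derivedPoint_of_norm_padicLogPoint
    (W : WeierstrassCurve ℚ) [W.IsElliptic] [W.IsGloballyMinimal] [NeZero (W.conductorNorm ℤ)]
    (hT2 : ∀ P : W.toAffine.Point, 2 • P = 0 → P = 0)
    (K : Type) [Field K] [NumberField K] (hIQ : IsImaginaryQuadratic K) (hodd : Odd (NumberField.discr K))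
    (hHe : SatisfiesHeegnerHypothesis (W.conductorNorm ℤ) K)
    (Dt : ModularParametrizationData W (W.conductorNorm ℤ)) (β : ℤ) (ι : K →+* ℂ) (d₁ : KolyvaginHeegnerData Dt β ι 1)
    (P₀ : (W.baseChange K).toAffine.Point)
    (hP₀K : WeierstrassCurve.Affine.Point.map (W' := W) (algebraMap K (ringClassField K ι 1)).toRatAlgHom P₀ = d₁.derivedPoint)
    (j : K →ₐ[ℚ] ℚ_[2]) (M : ℕ)
    (hnorm : haveI : Fact (Nat.Prime 2) := ⟨Nat.prime_two⟩;
      ((2 : ℝ)⁻¹) ^ (M + 2) < ‖(W.baseChange ℚ_[2]).padicLogPoint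
        ((((W.baseChange ℚ_[2]).localTamagawaNumber ℤ_[2]) * nsPointCountAtTwo W) • WeierstrassCurve.Affine.Point.map j P₀)‖) :
    ¬ ∃ Q : (W.baseChange (ringClassField K ι 1)).toAffine.Point, ((2 ^ (M + 1) : ℕ) : ℤ) • Q = d₁.derivedPoint := by
  haveI : Fact (Nat.Prime 2) := ⟨Nat.prime_two⟩
  haveI : (W.baseChange ℚ_[2]).IsMinimal ℤ_[2] := isMinimal_map_padic_of_isGloballyMinimal W 2
  rintro ⟨Q₁, hQ₁⟩
  -- descend the root to `E(K)`
  have htor1 : ∀ R : (W.baseChange (ringClassField K ι 1)).toAffine.Point, ((2 ^ (M + 1) : ℕ) : ℤ) • R = 0 → R = 0 :=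
    fun R hR ↦ eq_zero_of_two_pow_smul_eq_zero_ringClassField_of_noTwoTorsion W hIQ hodd hHe hT2 ι (M + 1) R hR
  have hdiv : X11b.Three.Koly.PDiv d₁ 2 (M + 1) := ⟨Q₁, hQ₁⟩
  obtain ⟨Q, hQ⟩ := (X11b.Three.Koly.pDiv_one_iff_exists_zsmul_eq hIQ d₁ P₀ hP₀K 2 (M + 1) htor1).mp hdiv
  -- the logarithm estimate one level up from Kriz–Li's Lemma 5.4
  set E₂ := W.baseChange ℚ_[2] with hE₂
  set m : ℕ := (W.baseChange ℚ_[2]).localTamagawaNumber ℤ_[2] * nsPointCountAtTwo W with hm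
  set f := WeierstrassCurve.Affine.Point.map (W' := W) j with hf
  have hQ₁' : E₂.IsInReductionKernel (m • f Q) := isInReductionKernel_tamagawa_mul_nsPointCountAtTwo_nsmul W (f Q)
  obtain ⟨-, hlogk⟩ := AcPConverseLinks.padicLogPoint_nsmul W 2 (m • f Q) hQ₁' (2 ^ (M + 1))
  have hP : m • f P₀ = (2 ^ (M + 1)) • (m • f Q) := by
    rw [← hQ, natCast_zsmul, map_nsmul, smul_smul, smul_smul, mul_comm]
  have h2norm : ‖((2 ^ (M + 1) : ℕ) : ℚ_[2])‖ = ((2 : ℝ)⁻¹) ^ (M + 1) := by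
    rw [Nat.cast_pow, Nat.cast_ofNat, norm_pow]
    congr 1
    exact_mod_cast Padic.norm_p (p := 2)
  have hQlog : ‖E₂.padicLogPoint (m • f Q)‖ ≤ 2⁻¹ := by
    have h := E₂.norm_padicLogPoint_le_of_isInReductionKernel hQ₁'
    exact_mod_cast h
  have hbound : ‖E₂.padicLogPoint (m • f P₀)‖ ≤ ((2 : ℝ)⁻¹) ^ (M + 1) * 2⁻¹ := by
    rw [hP, hlogk, norm_mul, h2norm]
    gcongr
  have : ((2 : ℝ)⁻¹) ^ (M + 2) = ((2 : ℝ)⁻¹) ^ (M + 1) * 2⁻¹ := pow_succ _ _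
  linarith

/-- **The certificate in (★)-currency.**  With `c₂(E)` odd: `‖log(m•P₂)/(c₂·c_E)‖ = 2^{-(t+1)}` iff `‖log(m•P₂)‖ = 2^{-(t+1)}·2^{-ord₂ c_E}` — so the
(★)-shaped value `2^{-(t+1)}` certifies NDIV at depth `M = ord₂ c_E + t` (EXP's depth `ord₂ c + ord₂ C(W)` at `t = ord₂ C(W)`); at `t = 0`, `c_E` odd it is
Kriz–Li's (★).  Bookkeeping (`‖c_E‖₂ = 2^{-ord₂ c_E}`, `‖c₂‖₂ = 1`); UNCONDITIONAL. [cite: KrizLi2019, Thm. 1.12 (★) and Lemma 5.4 (FMS)] -/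
theorem depthCertificate_iff_norm
    (W : WeierstrassCurve ℚ) [W.IsElliptic] [W.IsGloballyMinimal] {N : ℕ} [NeZero N] (Dt : ModularParametrizationData W N)
    (K : Type) [Field K] [NumberField K] (P₀ : (W.baseChange K).toAffine.Point) (j : K →ₐ[ℚ] ℚ_[2]) (t : ℕ)
    (hc2 : haveI : Fact (Nat.Prime 2) := ⟨Nat.prime_two⟩; Odd ((W.baseChange ℚ_[2]).localTamagawaNumber ℤ_[2])) (hc0 : Dt.c ≠ 0) :
    haveI : Fact (Nat.Prime 2) := ⟨Nat.prime_two⟩;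
    (‖(W.baseChange ℚ_[2]).padicLogPoint ((((W.baseChange ℚ_[2]).localTamagawaNumber ℤ_[2]) * nsPointCountAtTwo W) •
          WeierstrassCurve.Affine.Point.map j P₀) / ((((W.baseChange ℚ_[2]).localTamagawaNumber ℤ_[2] : ℕ) : ℚ_[2]) * (Dt.c : ℚ_[2]))‖ =
        ((2 : ℝ)⁻¹) ^ (t + 1) ↔
      ‖(W.baseChange ℚ_[2]).padicLogPoint ((((W.baseChange ℚ_[2]).localTamagawaNumber ℤ_[2]) * nsPointCountAtTwo W) •
          WeierstrassCurve.Affine.Point.map j P₀)‖ = ((2 : ℝ)⁻¹) ^ (t + 1) * ((2 : ℝ)⁻¹) ^ (padicValInt 2 Dt.c)) := by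
  haveI : Fact (Nat.Prime 2) := ⟨Nat.prime_two⟩
  have hc2n : ‖(((W.baseChange ℚ_[2]).localTamagawaNumber ℤ_[2] : ℕ) : ℚ_[2])‖ = 1 :=
    Padic.norm_natCast_eq_one_iff.mpr (Nat.coprime_two_left.mpr hc2)
  have hcn : ‖((Dt.c : ℤ) : ℚ_[2])‖ = ((2 : ℝ)⁻¹) ^ (padicValInt 2 Dt.c) := by
    rw [Padic.norm_eq_zpow_neg_valuation (by exact_mod_cast hc0), Padic.valuation_intCast, inv_pow, ← zpow_natCast, ← zpow_neg]
    norm_cast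
  have hcpos : (0 : ℝ) < ((2 : ℝ)⁻¹) ^ (padicValInt 2 Dt.c) := by positivity
  rw [norm_div, norm_mul, hc2n, one_mul, hcn, div_eq_iff hcpos.ne']

end Summit.BirchSwinnertonDyer.BirchSwinnertonDyer.Theorems.GenusExact.TwinSwap.DepthCertificate

end
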